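import Literature.NumberTheory.LFunctions.CoprimeIdealHarmonicSum
import Literature.NumberTheory.LFunctions.TwistedDedekindCoefficients
import HarnessLib

/-!
# Vaughan's identity on the ideals of a number field (Hinz 1988, §4 (4.1))

Topic `Literature/NumberTheory/Sieve`; namespace `Literature.NumberTheory.Sieve.NumberFieldVaughan`.
Everything in this file is PROVED (the definitions have bodies; no named facts).

**The printed identity** (J. G. Hinz, *A generalization of Bombieri's prime number theorem to
algebraic number fields*, Acta Arith. 51 (1988), §4): with `F(s) = ∑_{N𝔞 ≤ U} Λ(𝔞)N𝔞^{-s}`,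
`G(s) = ∑_{N𝔟 ≤ U} μ(𝔟)N𝔟^{-s}` and Vaughan's identity
`−ζ_K'/ζ_K = F − ζ_K F G − ζ_K' G + (−ζ_K'/ζ_K − F)(1 − ζ_K G)`, comparing coefficients gives

  (4.1) `Λ(𝔞) = a₁(𝔞) + a₂(𝔞) + a₃(𝔞) + a₄(𝔞)`,
  `a₁(𝔞) = Λ(𝔞)[N𝔞 ≤ U]`,  `a₂(𝔞) = −∑_{𝔟𝔠 ∣ 𝔞, N𝔟, N𝔠 ≤ U} Λ(𝔟)μ(𝔠)`,
  `a₃(𝔞) = ∑_{𝔟𝔠 = 𝔞, N𝔟 ≤ U} μ(𝔟) log N𝔠`,  `a₄(𝔞) = −∑_{𝔟𝔠 = 𝔞, N𝔟 > U, 𝔠 ≠ 1} Λ(𝔟) ∑_{𝔡 ∣ 𝔠, N𝔡 ≤ U} μ(𝔡)`.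

We prove (4.1) directly on the divisor lattice of a nonzero ideal `𝔞` (no Dirichlet series):
writing `Λ = Λ_≤ + Λ_>`, `μ_≤ = μ·[N ≤ U]` and `e_U(𝔠) = ∑_{𝔡 ∣ 𝔠, N𝔡 ≤ U} μ(𝔡)` (which is `[𝔠 = 1]`
when `N𝔠 ≤ U`, `eU_eq_of_absNorm_le`), one has `Λ_>(𝔞) = ∑_{𝔟𝔠=𝔞} Λ_>(𝔟)[𝔠 = 1]`,
`[𝔠 = 1] = e_U(𝔠) − e_U(𝔠)[𝔠 ≠ 1]`, and `∑_{𝔟𝔠=𝔞} Λ_>(𝔟) e_U(𝔠) = a₃(𝔞) + a₂(𝔞)` by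
`∑_{𝔟 ∣ 𝔞} Λ(𝔟) = log N𝔞` (the tree's `sum_divisors_idealVonMangoldt`) after interchanging the
divisor sums (`sum_divisors_comm`).

* `cofactor 𝔞 𝔟` (`= 𝔞/𝔟` for `𝔟 ∣ 𝔞`), `lamLE`, `lamGT`, `muLE`, `eU`, `vA1 … vA4` — the objects;
* `vaughan_identity` — (4.1) for every nonzero ideal `𝔞` and every `U`;
* `sum_mul_vonMangoldt_eq` — (4.1) summed against arbitrary weights `w(α)` over a finite set `B`
  of nonzero algebraic integers, with the divisor sums brought outside (Hinz's `S₁ + S₂ + S₃ + S₄`,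
  the shapes of `S₂, S₃` as on p. 185 and of `S₄` as on p. 186):
  `∑_{α∈B} w(α)Λ((α)) = ∑_α w a₁ − ∑_{N𝔟,N𝔠≤U} Λ(𝔟)μ(𝔠) ∑_{α∈B, 𝔟𝔠∣(α)} w(α)`
  `+ ∑_{N𝔟≤U} μ(𝔟) ∑_{α∈B, 𝔟∣(α)} w(α) log N((α)/𝔟) − ∑_{U<N𝔟≤X} Λ(𝔟) ∑_{α∈B, 𝔟∣(α), (α)≠𝔟} w(α) e_U((α)/𝔟)`
  (`X` any bound for the norms `N(α)`, `α ∈ B`).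

## References

* J. G. Hinz, Acta Arith. 51 (1988), 173–193, §4 (4.1) and pp. 184–186. [Hinz1988]
* R. C. Vaughan, *An elementary method in prime number theory*, Acta Arith. 37 (1980), 111–115. [Vaughan1980]

## Mathlib / tree search

Tree: `LFunctions.idealMoebius`, `sum_idealMoebius_of_dvd`, `idealMoebius_top` (`IdealMoebius.lean`);
`LFunctions.idealVonMangoldt`, `sum_divisors_idealVonMangoldt`, `idealVonMangoldt_nonneg`
(`TwistedDedekindCoefficients.lean`); `LFunctions.NumberField.idealDivisors`, `mem_idealDivisors`,
`idealsLE`, `mem_idealsLE` (`CoprimeIdealHarmonicSum.lean`). Mathlib: `Ideal.absNorm_dvd_absNorm_of_le`,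
`Ideal.le_of_dvd`, `mul_dvd_mul_iff_left`. `lean search 'vaughan.*Ideal|Vaughan.*numberField'`: nothing.
-/

noncomputable section

open Finset IsDedekindDomain
open scoped Classical

namespace Literature.NumberTheory.Sieve.NumberFieldVaughan

open Literature.NumberTheory.LFunctions (idealMoebius sum_idealMoebius_of_dvd idealMoebius_top idealVonMangoldt
  sum_divisors_idealVonMangoldt idealVonMangoldt_nonneg)
open Literature.NumberTheory.LFunctions.NumberField (idealDivisors mem_idealDivisors idealsLE mem_idealsLE)
open NumberField

variable {K : Type*} [Field K] [NumberField K]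

/-! ## Cofactors and divisor sums -/

/-- The cofactor `𝔞/𝔟` of a divisor `𝔟 ∣ 𝔞` (junk `⊥` otherwise). [folklore] -/
def cofactor (𝔞 𝔟 : Ideal (𝓞 K)) : Ideal (𝓞 K) := if h : 𝔟 ∣ 𝔞 then h.choose else ⊥

omit [NumberField K] in
/-- `𝔟 · (𝔞/𝔟) = 𝔞`. [folklore] -/
theorem mul_cofactor {𝔞 𝔟 : Ideal (𝓞 K)} (h : 𝔟 ∣ 𝔞) : 𝔟 * cofactor 𝔞 𝔟 = 𝔞 := by
  rw [cofactor, dif_pos h]; exact h.choose_spec.symm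

/-- The cofactor is determined by `𝔟 · 𝔠 = 𝔞` (`𝔟 ≠ 0`). [folklore] -/
theorem cofactor_eq_of_mul_eq {𝔞 𝔟 𝔠 : Ideal (𝓞 K)} (h𝔟 : 𝔟 ≠ ⊥) (h : 𝔟 * 𝔠 = 𝔞) : cofactor 𝔞 𝔟 = 𝔠 := by
  have hd : 𝔟 ∣ 𝔞 := ⟨𝔠, h.symm⟩
  have h2 : 𝔟 * cofactor 𝔞 𝔟 = 𝔟 * 𝔠 := (mul_cofactor hd).trans h.symm
  exact mul_left_cancel₀ h𝔟 h2

omit [NumberField K] in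
/-- `𝔞/𝔟 ≠ 0` for `𝔞 ≠ 0`. [folklore] -/
theorem cofactor_ne_bot {𝔞 𝔟 : Ideal (𝓞 K)} (h𝔞 : 𝔞 ≠ ⊥) (h : 𝔟 ∣ 𝔞) : cofactor 𝔞 𝔟 ≠ ⊥ := by
  intro h0
  have := mul_cofactor h
  rw [h0, Ideal.mul_bot] at this
  exact h𝔞 this.symm

omit [NumberField K] in
/-- `𝔞/𝔟 ∣ 𝔞`. [folklore] -/
theorem cofactor_dvd {𝔞 𝔟 : Ideal (𝓞 K)} (h : 𝔟 ∣ 𝔞) : cofactor 𝔞 𝔟 ∣ 𝔞 :=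
  ⟨𝔟, by rw [mul_comm]; exact (mul_cofactor h).symm⟩

/-- `𝔞/𝔞 = 1`. [folklore] -/
theorem cofactor_self {𝔞 : Ideal (𝓞 K)} (h𝔞 : 𝔞 ≠ ⊥) : cofactor 𝔞 𝔞 = ⊤ :=
  cofactor_eq_of_mul_eq h𝔞 (by rw [Ideal.mul_top])

/-- `𝔞/1 = 𝔞`. [folklore] -/
theorem cofactor_top (𝔞 : Ideal (𝓞 K)) : cofactor 𝔞 ⊤ = 𝔞 :=
  cofactor_eq_of_mul_eq (by simp) (by rw [Ideal.top_mul])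

/-- `𝔞/𝔟 = 1 ↔ 𝔟 = 𝔞` for `𝔟 ∣ 𝔞`, `𝔞 ≠ 0`. [folklore] -/
theorem cofactor_eq_top_iff {𝔞 𝔟 : Ideal (𝓞 K)} (h𝔞 : 𝔞 ≠ ⊥) (h : 𝔟 ∣ 𝔞) : cofactor 𝔞 𝔟 = ⊤ ↔ 𝔟 = 𝔞 := by
  constructor
  · intro ht; have := mul_cofactor h; rwa [ht, Ideal.mul_top] at this
  · rintro rfl; exact cofactor_self h𝔞

/-- **`𝔡 ∣ 𝔞/𝔟 ↔ 𝔟𝔡 ∣ 𝔞`** for `𝔟 ∣ 𝔞`, `𝔟 ≠ 0`. [folklore] -/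
theorem dvd_cofactor_iff {𝔞 𝔟 𝔡 : Ideal (𝓞 K)} (h𝔟 : 𝔟 ≠ ⊥) (h : 𝔟 ∣ 𝔞) : 𝔡 ∣ cofactor 𝔞 𝔟 ↔ 𝔟 * 𝔡 ∣ 𝔞 := by
  conv_rhs => rw [← mul_cofactor h]
  exact (mul_dvd_mul_iff_left h𝔟).symm

/-- `(𝔞/𝔟)/𝔡 = 𝔞/(𝔟𝔡)`. [folklore] -/
theorem cofactor_cofactor {𝔞 𝔟 𝔡 : Ideal (𝓞 K)} (h𝔞 : 𝔞 ≠ ⊥) (h : 𝔟 ∣ 𝔞) (hd : 𝔟 * 𝔡 ∣ 𝔞) :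
    cofactor (cofactor 𝔞 𝔟) 𝔡 = cofactor 𝔞 (𝔟 * 𝔡) := by
  have h𝔟 : 𝔟 ≠ ⊥ := fun h0 => h𝔞 (by obtain ⟨c, hc⟩ := h; rw [hc, h0, Ideal.bot_mul])
  have h𝔡' : 𝔡 ∣ cofactor 𝔞 𝔟 := (dvd_cofactor_iff h𝔟 h).2 hd
  have h𝔟𝔡 : 𝔟 * 𝔡 ≠ ⊥ := fun h0 => h𝔞 (by obtain ⟨c, hc⟩ := hd; rw [hc, h0, Ideal.bot_mul])
  refine (cofactor_eq_of_mul_eq h𝔟𝔡 ?_).symm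
  rw [mul_assoc, mul_cofactor h𝔡', mul_cofactor h]

/-- Divisors of a nonzero ideal are nonzero. [folklore] -/
theorem ne_bot_of_mem_idealDivisors {𝔞 𝔟 : Ideal (𝓞 K)} (h𝔞 : 𝔞 ≠ ⊥) (h : 𝔟 ∈ idealDivisors K 𝔞) : 𝔟 ≠ ⊥ := by
  rw [mem_idealDivisors h𝔞] at h
  intro h0; obtain ⟨c, hc⟩ := h; exact h𝔞 (by rw [hc, h0, Ideal.bot_mul])

/-- **Interchanging two divisor sums**: `∑_{𝔟 ∣ 𝔞} ∑_{𝔡 ∣ 𝔞/𝔟} F(𝔟, 𝔡) = ∑_{𝔡 ∣ 𝔞} ∑_{𝔟 ∣ 𝔞/𝔡} F(𝔟, 𝔡)`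
(both are the sum over the pairs with `𝔟𝔡 ∣ 𝔞`). [folklore] -/
theorem sum_divisors_comm {𝔞 : Ideal (𝓞 K)} (h𝔞 : 𝔞 ≠ ⊥) (F : Ideal (𝓞 K) → Ideal (𝓞 K) → ℝ) :
    ∑ 𝔟 ∈ idealDivisors K 𝔞, ∑ 𝔡 ∈ idealDivisors K (cofactor 𝔞 𝔟), F 𝔟 𝔡 =
      ∑ 𝔡 ∈ idealDivisors K 𝔞, ∑ 𝔟 ∈ idealDivisors K (cofactor 𝔞 𝔡), F 𝔟 𝔡 := by
  -- both sides equal the sum over the pairs `(𝔟, 𝔡) ∈ div 𝔞 × div 𝔞` with `𝔟𝔡 ∣ 𝔞`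
  have hL : ∀ 𝔟 ∈ idealDivisors K 𝔞, ∑ 𝔡 ∈ idealDivisors K (cofactor 𝔞 𝔟), F 𝔟 𝔡 =
      ∑ 𝔡 ∈ (idealDivisors K 𝔞).filter (fun 𝔡 => 𝔟 * 𝔡 ∣ 𝔞), F 𝔟 𝔡 := by
    intro 𝔟 h𝔟
    have h𝔟0 := ne_bot_of_mem_idealDivisors h𝔞 h𝔟
    have h𝔟d := (mem_idealDivisors h𝔞).1 h𝔟
    refine Finset.sum_congr ?_ fun _ _ => rfl
    ext 𝔡
    rw [mem_idealDivisors (cofactor_ne_bot h𝔞 h𝔟d), Finset.mem_filter, mem_idealDivisors h𝔞, dvd_cofactor_iff h𝔟0 h𝔟d]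
    constructor
    · intro h; exact ⟨dvd_trans (Dvd.intro_left _ rfl) h, h⟩
    · intro h; exact h.2
  have hR : ∀ 𝔡 ∈ idealDivisors K 𝔞, ∑ 𝔟 ∈ idealDivisors K (cofactor 𝔞 𝔡), F 𝔟 𝔡 =
      ∑ 𝔟 ∈ (idealDivisors K 𝔞).filter (fun 𝔟 => 𝔟 * 𝔡 ∣ 𝔞), F 𝔟 𝔡 := by
    intro 𝔡 h𝔡
    have h𝔡0 := ne_bot_of_mem_idealDivisors h𝔞 h𝔡
    have h𝔡d := (mem_idealDivisors h𝔞).1 h𝔡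
    refine Finset.sum_congr ?_ fun _ _ => rfl
    ext 𝔟
    rw [mem_idealDivisors (cofactor_ne_bot h𝔞 h𝔡d), Finset.mem_filter, mem_idealDivisors h𝔞, dvd_cofactor_iff h𝔡0 h𝔡d,
      mul_comm]
    constructor
    · intro h; exact ⟨dvd_trans (Dvd.intro _ rfl) h, h⟩
    · intro h; exact h.2
  rw [Finset.sum_congr rfl hL, Finset.sum_congr rfl hR]
  simp_rw [Finset.sum_filter]
  exact Finset.sum_comm

/-! ## The objects of the identity -/

variable (K)

/-- `Λ_≤(𝔞) = Λ(𝔞)[N𝔞 ≤ U]`. [cite: Hinz1988, §4 (4.1)] -/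
def lamLE (U : ℝ) (𝔞 : Ideal (𝓞 K)) : ℝ := if (Ideal.absNorm 𝔞 : ℝ) ≤ U then idealVonMangoldt 𝔞 else 0

/-- `Λ_>(𝔞) = Λ(𝔞)[N𝔞 > U]`. [cite: Hinz1988, §4 (4.1)] -/
def lamGT (U : ℝ) (𝔞 : Ideal (𝓞 K)) : ℝ := if (Ideal.absNorm 𝔞 : ℝ) ≤ U then 0 else idealVonMangoldt 𝔞

/-- `μ_≤(𝔟) = μ(𝔟)[N𝔟 ≤ U]`. [cite: Hinz1988, §4 (4.1)] -/
def muLE (U : ℝ) (𝔟 : Ideal (𝓞 K)) : ℝ := if (Ideal.absNorm 𝔟 : ℝ) ≤ U then (idealMoebius 𝔟 : ℝ) else 0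

/-- `e_U(𝔠) = ∑_{𝔡 ∣ 𝔠, N𝔡 ≤ U} μ(𝔡)`. [cite: Hinz1988, §4 (a₄)] -/
def eU (U : ℝ) (𝔠 : Ideal (𝓞 K)) : ℝ := ∑ 𝔡 ∈ idealDivisors K 𝔠, muLE K U 𝔡

/-- `a₁(𝔞) = Λ(𝔞)[N𝔞 ≤ U]`. [cite: Hinz1988, §4 (4.1)] -/
def vA1 (U : ℝ) (𝔞 : Ideal (𝓞 K)) : ℝ := lamLE K U 𝔞

/-- `a₂(𝔞) = −∑_{𝔟 ∣ 𝔞} Λ_≤(𝔟) ∑_{𝔠 ∣ 𝔞/𝔟} μ_≤(𝔠)` (`= −∑_{𝔟𝔠𝔡 = 𝔞, N𝔟, N𝔠 ≤ U} Λ(𝔟)μ(𝔠)`).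
[cite: Hinz1988, §4 (4.1)] -/
def vA2 (U : ℝ) (𝔞 : Ideal (𝓞 K)) : ℝ :=
  -∑ 𝔟 ∈ idealDivisors K 𝔞, lamLE K U 𝔟 * ∑ 𝔠 ∈ idealDivisors K (cofactor 𝔞 𝔟), muLE K U 𝔠

/-- `a₃(𝔞) = ∑_{𝔟 ∣ 𝔞} μ_≤(𝔟) log N(𝔞/𝔟)`. [cite: Hinz1988, §4 (4.1)] -/
def vA3 (U : ℝ) (𝔞 : Ideal (𝓞 K)) : ℝ :=
  ∑ 𝔟 ∈ idealDivisors K 𝔞, muLE K U 𝔟 * Real.log (Ideal.absNorm (cofactor 𝔞 𝔟))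

/-- `a₄(𝔞) = −∑_{𝔟 ∣ 𝔞, 𝔞/𝔟 ≠ 1} Λ_>(𝔟) e_U(𝔞/𝔟)`. [cite: Hinz1988, §4 (4.1)] -/
def vA4 (U : ℝ) (𝔞 : Ideal (𝓞 K)) : ℝ :=
  -∑ 𝔟 ∈ (idealDivisors K 𝔞).filter (fun 𝔟 => cofactor 𝔞 𝔟 ≠ ⊤), lamGT K U 𝔟 * eU K U (cofactor 𝔞 𝔟)

variable {K}

/-- `Λ = Λ_≤ + Λ_>`. [folklore] -/
theorem lamLE_add_lamGT (U : ℝ) (𝔞 : Ideal (𝓞 K)) : lamLE K U 𝔞 + lamGT K U 𝔞 = idealVonMangoldt 𝔞 := by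
  unfold lamLE lamGT; split_ifs <;> simp

/-- **`e_U(𝔠) = [𝔠 = 1]` for `N𝔠 ≤ U`** (all divisors of `𝔠` then have norm `≤ U`).
[cite: Hinz1988, §4 (p. 186, `∑_{𝔡∣𝔠, N𝔡≤U} μ(𝔡) = 0` for `1 < N𝔠 ≤ U`)] -/
theorem eU_eq_of_absNorm_le {U : ℝ} {𝔠 : Ideal (𝓞 K)} (h𝔠 : 𝔠 ≠ ⊥) (hU : (Ideal.absNorm 𝔠 : ℝ) ≤ U) :
    eU K U 𝔠 = if 𝔠 = ⊤ then 1 else 0 := by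
  unfold eU
  have h1 : ∀ 𝔡 ∈ idealDivisors K 𝔠, muLE K U 𝔡 = (idealMoebius 𝔡 : ℝ) := by
    intro 𝔡 h𝔡
    have hd := (mem_idealDivisors h𝔠).1 h𝔡
    have hle : (Ideal.absNorm 𝔡 : ℝ) ≤ Ideal.absNorm 𝔠 := by
      have := Nat.le_of_dvd (Nat.pos_of_ne_zero (by rwa [Ne, Ideal.absNorm_eq_zero_iff]))
        (Ideal.absNorm_dvd_absNorm_of_le (Ideal.le_of_dvd hd))
      exact_mod_cast this
    rw [muLE, if_pos (hle.trans hU)]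
  rw [Finset.sum_congr rfl h1, ← Int.cast_sum, sum_idealMoebius_of_dvd h𝔠 fun _ => mem_idealDivisors h𝔠]
  split_ifs <;> simp

/-- `e_U(1) = 1` for `U ≥ 1`. [folklore] -/
theorem eU_top {U : ℝ} (hU : 1 ≤ U) : eU K U (⊤ : Ideal (𝓞 K)) = 1 := by
  rw [eU_eq_of_absNorm_le (by simp) (by simpa using hU), if_pos rfl]

/-- `∑_{𝔟 ∣ 𝔞} Λ(𝔟) = log N𝔞` in the `idealDivisors` form. [cite: Hinz1988, §4] -/
theorem sum_idealDivisors_vonMangoldt {𝔞 : Ideal (𝓞 K)} (h𝔞 : 𝔞 ≠ ⊥) :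
    ∑ 𝔟 ∈ idealDivisors K 𝔞, idealVonMangoldt 𝔟 = Real.log (Ideal.absNorm 𝔞) :=
  sum_divisors_idealVonMangoldt h𝔞 fun _ => mem_idealDivisors h𝔞

/-- `∑_{𝔟 ∣ 𝔞} Λ_>(𝔟) = log N𝔞 − ∑_{𝔟 ∣ 𝔞} Λ_≤(𝔟)`. [folklore] -/
theorem sum_idealDivisors_lamGT {𝔞 : Ideal (𝓞 K)} (h𝔞 : 𝔞 ≠ ⊥) (U : ℝ) :
    ∑ 𝔟 ∈ idealDivisors K 𝔞, lamGT K U 𝔟 = Real.log (Ideal.absNorm 𝔞) - ∑ 𝔟 ∈ idealDivisors K 𝔞, lamLE K U 𝔟 := by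
  rw [eq_sub_iff_add_eq, add_comm, ← Finset.sum_add_distrib, Finset.sum_congr rfl fun 𝔟 _ => lamLE_add_lamGT U 𝔟]
  exact sum_idealDivisors_vonMangoldt h𝔞

/-! ## The identity -/

/-- The key convolution identity: `∑_{𝔟 ∣ 𝔞} Λ_>(𝔟) e_U(𝔞/𝔟) = a₃(𝔞) + a₂(𝔞)`.
[cite: Hinz1988, §4 (4.1)] -/
theorem sum_lamGT_mul_eU {𝔞 : Ideal (𝓞 K)} (h𝔞 : 𝔞 ≠ ⊥) (U : ℝ) :
    ∑ 𝔟 ∈ idealDivisors K 𝔞, lamGT K U 𝔟 * eU K U (cofactor 𝔞 𝔟) = vA3 K U 𝔞 + vA2 K U 𝔞 := by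
  unfold eU vA3 vA2
  -- swap the sums: `∑_𝔟 Λ_>(𝔟) ∑_{𝔡 ∣ 𝔞/𝔟} μ_≤(𝔡) = ∑_𝔡 μ_≤(𝔡) ∑_{𝔟 ∣ 𝔞/𝔡} Λ_>(𝔟)`
  simp_rw [Finset.mul_sum]
  rw [sum_divisors_comm h𝔞 (fun 𝔟 𝔡 => lamGT K U 𝔟 * muLE K U 𝔡)]
  -- evaluate the inner sums
  have h1 : ∀ 𝔡 ∈ idealDivisors K 𝔞, ∑ 𝔟 ∈ idealDivisors K (cofactor 𝔞 𝔡), lamGT K U 𝔟 * muLE K U 𝔡 =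
      muLE K U 𝔡 * Real.log (Ideal.absNorm (cofactor 𝔞 𝔡)) -
        muLE K U 𝔡 * ∑ 𝔟 ∈ idealDivisors K (cofactor 𝔞 𝔡), lamLE K U 𝔟 := by
    intro 𝔡 h𝔡
    have hc := cofactor_ne_bot h𝔞 ((mem_idealDivisors h𝔞).1 h𝔡)
    rw [← Finset.sum_mul, sum_idealDivisors_lamGT hc U]; ring
  rw [Finset.sum_congr rfl h1, Finset.sum_sub_distrib, sub_eq_add_neg]
  congr 1
  -- swap back in the second sum
  rw [neg_inj, sum_divisors_comm h𝔞 (fun 𝔟 𝔡 => lamLE K U 𝔟 * muLE K U 𝔡)]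
  refine Finset.sum_congr rfl fun 𝔡 _ => ?_
  rw [Finset.mul_sum]
  exact Finset.sum_congr rfl fun 𝔟 _ => by ring

/-- **Vaughan's identity on the ideals of `𝓞_K` (Hinz (4.1))**: for every nonzero ideal `𝔞` and every
`U ≥ 1`, `Λ(𝔞) = a₁(𝔞) + a₂(𝔞) + a₃(𝔞) + a₄(𝔞)`. [cite: Hinz1988, §4 (4.1)] -/
theorem vaughan_identity {U : ℝ} (hU : 1 ≤ U) {𝔞 : Ideal (𝓞 K)} (h𝔞 : 𝔞 ≠ ⊥) :
    idealVonMangoldt 𝔞 = vA1 K U 𝔞 + vA2 K U 𝔞 + vA3 K U 𝔞 + vA4 K U 𝔞 := by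
  -- `Λ_>(𝔞) = ∑_{𝔟 ∣ 𝔞} Λ_>(𝔟)[𝔞/𝔟 = 1] = ∑_𝔟 Λ_>(𝔟) e_U(𝔞/𝔟) − ∑_{𝔟, 𝔞/𝔟 ≠ 1} Λ_>(𝔟) e_U(𝔞/𝔟)`
  have hmem : 𝔞 ∈ idealDivisors K 𝔞 := (mem_idealDivisors h𝔞).2 dvd_rfl
  have h1 : lamGT K U 𝔞 = ∑ 𝔟 ∈ idealDivisors K 𝔞,
      if cofactor 𝔞 𝔟 = ⊤ then lamGT K U 𝔟 * eU K U (cofactor 𝔞 𝔟) else 0 := by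
    rw [← Finset.sum_filter]
    have hfil : (idealDivisors K 𝔞).filter (fun 𝔟 => cofactor 𝔞 𝔟 = ⊤) = {𝔞} := by
      ext 𝔟
      rw [Finset.mem_filter, Finset.mem_singleton]
      constructor
      · intro h; exact (cofactor_eq_top_iff h𝔞 ((mem_idealDivisors h𝔞).1 h.1)).1 h.2
      · rintro rfl; exact ⟨hmem, cofactor_self h𝔞⟩
    rw [hfil, Finset.sum_singleton, cofactor_self h𝔞, eU_top hU, mul_one]
  have h2 : ∑ 𝔟 ∈ idealDivisors K 𝔞, (if cofactor 𝔞 𝔟 = ⊤ then lamGT K U 𝔟 * eU K U (cofactor 𝔞 𝔟) else 0) =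
      (∑ 𝔟 ∈ idealDivisors K 𝔞, lamGT K U 𝔟 * eU K U (cofactor 𝔞 𝔟)) + vA4 K U 𝔞 := by
    rw [vA4, ← Finset.sum_filter, ← sub_eq_add_neg, eq_sub_iff_add_eq]
    exact Finset.sum_filter_add_sum_filter_not _ _ _
  rw [← lamLE_add_lamGT U 𝔞, h1, h2, sum_lamGT_mul_eU h𝔞 U, vA1]
  ring

/-! ## The identity summed against weights over algebraic integers -/

section Summed

open scoped nonZeroDivisors

/-- For a nonzero integer, `N((α)) = |N α|`. [folklore] -/
theorem absNorm_span_eq_abs_norm (α : 𝓞 K) :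
    (Ideal.absNorm (Ideal.span {α}) : ℝ) = |(Algebra.norm ℚ (α : K) : ℝ)| := by
  rw [Ideal.absNorm_span_singleton, ← Algebra.coe_norm_int α, Rat.cast_intCast, Nat.cast_natAbs, Int.cast_abs]

/-- The norm of a nonzero algebraic integer's ideal is at most a bound `X` for `|N α|`. [folklore] -/
theorem absNorm_span_le_of_le {α : 𝓞 K} {X : ℝ} (h : |(Algebra.norm ℚ (α : K) : ℝ)| ≤ X) :
    (Ideal.absNorm (Ideal.span {α}) : ℝ) ≤ X := by
  rw [absNorm_span_eq_abs_norm]; exact h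

/-- Divisors of norm `≤ U` of a nonzero ideal `𝔞`, listed inside `idealsLE K U`. [folklore] -/
theorem filter_idealDivisors_eq {𝔞 : Ideal (𝓞 K)} (h𝔞 : 𝔞 ≠ ⊥) (U : ℝ) :
    (idealDivisors K 𝔞).filter (fun 𝔟 => (Ideal.absNorm 𝔟 : ℝ) ≤ U) = (idealsLE K U).filter (· ∣ 𝔞) := by
  ext 𝔟
  rw [Finset.mem_filter, Finset.mem_filter, mem_idealDivisors h𝔞, mem_idealsLE]
  constructor
  · rintro ⟨hd, hU⟩
    exact ⟨⟨fun h0 => h𝔞 (by rw [h0] at hd; exact zero_dvd_iff.1 hd), hU⟩, hd⟩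
  · rintro ⟨⟨_, hU⟩, hd⟩; exact ⟨hd, hU⟩

/-- The inner Möbius sum of `a₂` through `idealsLE`: for `𝔟 ∣ 𝔞`, `𝔟 ≠ 0`,
`∑_{𝔠 ∣ 𝔞/𝔟} μ_≤(𝔠) = ∑_{N𝔠 ≤ U} μ(𝔠) [𝔟𝔠 ∣ 𝔞]`. [folklore] -/
theorem sum_muLE_cofactor_eq {𝔞 𝔟 : Ideal (𝓞 K)} (h𝔞 : 𝔞 ≠ ⊥) (h𝔟0 : 𝔟 ≠ ⊥) (h𝔟 : 𝔟 ∣ 𝔞) (U : ℝ) :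
    ∑ 𝔠 ∈ idealDivisors K (cofactor 𝔞 𝔟), muLE K U 𝔠 =
      ∑ 𝔠 ∈ idealsLE K U, if 𝔟 * 𝔠 ∣ 𝔞 then (idealMoebius 𝔠 : ℝ) else 0 := by
  have hc0 := cofactor_ne_bot h𝔞 h𝔟
  -- drop the terms with `N𝔠 > U`
  have h1 : ∑ 𝔠 ∈ idealDivisors K (cofactor 𝔞 𝔟), muLE K U 𝔠 =
      ∑ 𝔠 ∈ (idealDivisors K (cofactor 𝔞 𝔟)).filter (fun 𝔠 => (Ideal.absNorm 𝔠 : ℝ) ≤ U), (idealMoebius 𝔠 : ℝ) := by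
    rw [Finset.sum_filter]
    refine Finset.sum_congr rfl fun 𝔠 _ => ?_
    unfold muLE; rfl
  rw [h1, filter_idealDivisors_eq hc0 U, Finset.sum_filter]
  refine Finset.sum_congr rfl fun 𝔠 _ => ?_
  rw [dvd_cofactor_iff h𝔟0 h𝔟]

/-- **Hinz's `S₂` shape**: for nonzero `𝔞`,
`a₂(𝔞) = −∑_{N𝔟≤U} ∑_{N𝔠≤U} Λ(𝔟)μ(𝔠) [𝔟𝔠 ∣ 𝔞]`. [cite: Hinz1988, §4 p. 185 (S₂)] -/
theorem vA2_eq {U : ℝ} {𝔞 : Ideal (𝓞 K)} (h𝔞 : 𝔞 ≠ ⊥) :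
    vA2 K U 𝔞 = -∑ 𝔟 ∈ idealsLE K U, ∑ 𝔠 ∈ idealsLE K U,
      if 𝔟 * 𝔠 ∣ 𝔞 then idealVonMangoldt 𝔟 * (idealMoebius 𝔠 : ℝ) else 0 := by
  unfold vA2
  congr 1
  -- the outer sum: only divisors with `N𝔟 ≤ U` contribute
  have h1 : ∑ 𝔟 ∈ idealDivisors K 𝔞, lamLE K U 𝔟 * ∑ 𝔠 ∈ idealDivisors K (cofactor 𝔞 𝔟), muLE K U 𝔠 =
      ∑ 𝔟 ∈ (idealDivisors K 𝔞).filter (fun 𝔟 => (Ideal.absNorm 𝔟 : ℝ) ≤ U),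
        idealVonMangoldt 𝔟 * ∑ 𝔠 ∈ idealDivisors K (cofactor 𝔞 𝔟), muLE K U 𝔠 := by
    rw [Finset.sum_filter]
    refine Finset.sum_congr rfl fun 𝔟 _ => ?_
    unfold lamLE; split_ifs <;> simp
  rw [h1, filter_idealDivisors_eq h𝔞 U, Finset.sum_filter]
  refine Finset.sum_congr rfl fun 𝔟 h𝔟 => ?_
  have h𝔟0 := (mem_idealsLE.1 h𝔟).1
  split_ifs with hd
  · rw [sum_muLE_cofactor_eq h𝔞 h𝔟0 hd U, Finset.mul_sum]
    refine Finset.sum_congr rfl fun 𝔠 _ => ?_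
    split_ifs <;> simp
  · refine (Finset.sum_eq_zero fun 𝔠 _ => ?_).symm
    rw [if_neg]
    exact fun h => hd (dvd_trans (Dvd.intro _ rfl) h)

/-- **Hinz's `S₃` shape**: `a₃(𝔞) = ∑_{N𝔟 ≤ U} μ(𝔟) [𝔟 ∣ 𝔞] log N(𝔞/𝔟)`. [cite: Hinz1988, §4 (4.4)] -/
theorem vA3_eq {U : ℝ} {𝔞 : Ideal (𝓞 K)} (h𝔞 : 𝔞 ≠ ⊥) :
    vA3 K U 𝔞 = ∑ 𝔟 ∈ idealsLE K U,
      if 𝔟 ∣ 𝔞 then (idealMoebius 𝔟 : ℝ) * Real.log (Ideal.absNorm (cofactor 𝔞 𝔟)) else 0 := by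
  unfold vA3
  have h1 : ∑ 𝔟 ∈ idealDivisors K 𝔞, muLE K U 𝔟 * Real.log (Ideal.absNorm (cofactor 𝔞 𝔟)) =
      ∑ 𝔟 ∈ (idealDivisors K 𝔞).filter (fun 𝔟 => (Ideal.absNorm 𝔟 : ℝ) ≤ U),
        (idealMoebius 𝔟 : ℝ) * Real.log (Ideal.absNorm (cofactor 𝔞 𝔟)) := by
    rw [Finset.sum_filter]
    refine Finset.sum_congr rfl fun 𝔟 _ => ?_
    unfold muLE; split_ifs <;> simp
  rw [h1, filter_idealDivisors_eq h𝔞 U, Finset.sum_filter]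

/-- **Hinz's `S₄` shape**: `a₄(𝔞) = −∑_{U < N𝔟 ≤ X} Λ(𝔟) [𝔟 ∣ 𝔞, 𝔞/𝔟 ≠ 1] e_U(𝔞/𝔟)` for any
`X ≥ N𝔞`. [cite: Hinz1988, §4 p. 186 (S₄)] -/
theorem vA4_eq {U X : ℝ} {𝔞 : Ideal (𝓞 K)} (h𝔞 : 𝔞 ≠ ⊥) (hX : (Ideal.absNorm 𝔞 : ℝ) ≤ X) :
    vA4 K U 𝔞 = -∑ 𝔟 ∈ (idealsLE K X).filter (fun 𝔟 => U < (Ideal.absNorm 𝔟 : ℝ)),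
      if 𝔟 ∣ 𝔞 ∧ cofactor 𝔞 𝔟 ≠ ⊤ then idealVonMangoldt 𝔟 * eU K U (cofactor 𝔞 𝔟) else 0 := by
  unfold vA4
  congr 1
  -- right: the condition `𝔟 ∣ 𝔞` as a filter
  have hR : ∑ 𝔟 ∈ (idealsLE K X).filter (fun 𝔟 => U < (Ideal.absNorm 𝔟 : ℝ)),
      (if 𝔟 ∣ 𝔞 ∧ cofactor 𝔞 𝔟 ≠ ⊤ then idealVonMangoldt 𝔟 * eU K U (cofactor 𝔞 𝔟) else 0) =
      ∑ 𝔟 ∈ ((idealsLE K X).filter (fun 𝔟 => U < (Ideal.absNorm 𝔟 : ℝ))).filter (· ∣ 𝔞),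
        if cofactor 𝔞 𝔟 ≠ ⊤ then idealVonMangoldt 𝔟 * eU K U (cofactor 𝔞 𝔟) else 0 := by
    rw [Finset.sum_filter (p := (· ∣ 𝔞))]
    refine Finset.sum_congr rfl fun 𝔟 _ => ?_
    by_cases hd : 𝔟 ∣ 𝔞
    · simp only [hd, true_and, if_true]
    · simp only [hd, false_and, if_false]
  -- left: through `Λ_> = Λ [N > U]`
  have hL : ∑ 𝔟 ∈ (idealDivisors K 𝔞).filter (fun 𝔟 => cofactor 𝔞 𝔟 ≠ ⊤), lamGT K U 𝔟 * eU K U (cofactor 𝔞 𝔟) =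
      ∑ 𝔟 ∈ (idealDivisors K 𝔞).filter (fun 𝔟 => U < (Ideal.absNorm 𝔟 : ℝ)),
        if cofactor 𝔞 𝔟 ≠ ⊤ then idealVonMangoldt 𝔟 * eU K U (cofactor 𝔞 𝔟) else 0 := by
    rw [Finset.sum_filter, Finset.sum_filter]
    refine Finset.sum_congr rfl fun 𝔟 _ => ?_
    unfold lamGT
    by_cases hU : (Ideal.absNorm 𝔟 : ℝ) ≤ U
    · rw [if_neg (not_lt.2 hU)]; split_ifs <;> simp
    · rw [if_pos (not_le.1 hU)]; simp only [hU, if_false]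
  have hset : (idealDivisors K 𝔞).filter (fun 𝔟 => U < (Ideal.absNorm 𝔟 : ℝ)) =
      ((idealsLE K X).filter (fun 𝔟 => U < (Ideal.absNorm 𝔟 : ℝ))).filter (· ∣ 𝔞) := by
    ext 𝔟
    simp only [Finset.mem_filter, mem_idealDivisors h𝔞, mem_idealsLE]
    constructor
    · rintro ⟨hd, hU⟩
      refine ⟨⟨⟨fun h0 => h𝔞 (by rw [h0] at hd; exact zero_dvd_iff.1 hd), ?_⟩, hU⟩, hd⟩
      have := Nat.le_of_dvd (Nat.pos_of_ne_zero (by rwa [Ne, Ideal.absNorm_eq_zero_iff]))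
        (Ideal.absNorm_dvd_absNorm_of_le (Ideal.le_of_dvd hd))
      exact le_trans (by exact_mod_cast this) hX
    · rintro ⟨⟨⟨_, _⟩, hU⟩, hd⟩; exact ⟨hd, hU⟩
  rw [hR, ← hset, hL]

/-- **Vaughan's identity summed against weights** (Hinz's `S₁ + S₂ + S₃ + S₄`, with the divisor sums
outside): for a finite set `B` of nonzero algebraic integers, weights `w`, `U ≥ 1` and `X` with
`|N α| ≤ X` on `B`,
`∑_{α∈B} w(α) Λ((α)) = ∑_α w(α) a₁((α)) − ∑_{N𝔟≤U}∑_{N𝔠≤U} Λ(𝔟)μ(𝔠) ∑_{α∈B, 𝔟𝔠∣(α)} w(α)`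
`+ ∑_{N𝔟≤U} μ(𝔟) ∑_{α∈B, 𝔟∣(α)} w(α) log N((α)/𝔟) − ∑_{U<N𝔟≤X} Λ(𝔟) ∑_{α∈B, 𝔟∣(α), (α)≠𝔟} w(α) e_U((α)/𝔟)`.
[cite: Hinz1988, §4 (4.1)–(4.4) and p. 186] -/
theorem sum_mul_vonMangoldt_eq {U X : ℝ} (hU : 1 ≤ U) (B : Finset (𝓞 K)) (hB : ∀ α ∈ B, α ≠ 0)
    (hX : ∀ α ∈ B, |(Algebra.norm ℚ (α : K) : ℝ)| ≤ X) (w : 𝓞 K → ℝ) :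
    ∑ α ∈ B, w α * idealVonMangoldt (Ideal.span {α}) =
      (∑ α ∈ B, w α * vA1 K U (Ideal.span {α})) -
      (∑ 𝔟 ∈ idealsLE K U, ∑ 𝔠 ∈ idealsLE K U, idealVonMangoldt 𝔟 * (idealMoebius 𝔠 : ℝ) *
        ∑ α ∈ B.filter (fun α => 𝔟 * 𝔠 ∣ Ideal.span {α}), w α) +
      (∑ 𝔟 ∈ idealsLE K U, (idealMoebius 𝔟 : ℝ) *
        ∑ α ∈ B.filter (fun α => 𝔟 ∣ Ideal.span {α}), w α * Real.log (Ideal.absNorm (cofactor (Ideal.span {α}) 𝔟))) -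
      ∑ 𝔟 ∈ (idealsLE K X).filter (fun 𝔟 => U < (Ideal.absNorm 𝔟 : ℝ)), idealVonMangoldt 𝔟 *
        ∑ α ∈ B.filter (fun α => 𝔟 ∣ Ideal.span {α} ∧ cofactor (Ideal.span {α}) 𝔟 ≠ ⊤),
          w α * eU K U (cofactor (Ideal.span {α}) 𝔟) := by
  have hne : ∀ α ∈ B, Ideal.span {α} ≠ ⊥ := fun α hα => by rw [Ne, Ideal.span_singleton_eq_bot]; exact hB α hα
  have hXn : ∀ α ∈ B, (Ideal.absNorm (Ideal.span {α}) : ℝ) ≤ X := fun α hα => by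
    rw [absNorm_span_eq_abs_norm]; exact hX α hα
  -- apply (4.1) termwise
  have h1 : ∑ α ∈ B, w α * idealVonMangoldt (Ideal.span {α}) =
      (∑ α ∈ B, w α * vA1 K U (Ideal.span {α})) + (∑ α ∈ B, w α * vA2 K U (Ideal.span {α})) +
      (∑ α ∈ B, w α * vA3 K U (Ideal.span {α})) + ∑ α ∈ B, w α * vA4 K U (Ideal.span {α}) := by
    rw [← Finset.sum_add_distrib, ← Finset.sum_add_distrib, ← Finset.sum_add_distrib]
    refine Finset.sum_congr rfl fun α hα => ?_
    rw [vaughan_identity hU (hne α hα)]; ring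
  -- the three swaps
  have h2 : ∑ α ∈ B, w α * vA2 K U (Ideal.span {α}) =
      -∑ 𝔟 ∈ idealsLE K U, ∑ 𝔠 ∈ idealsLE K U, idealVonMangoldt 𝔟 * (idealMoebius 𝔠 : ℝ) *
        ∑ α ∈ B.filter (fun α => 𝔟 * 𝔠 ∣ Ideal.span {α}), w α := by
    rw [Finset.sum_congr rfl fun α hα => by rw [vA2_eq (hne α hα)]]
    simp_rw [mul_neg, Finset.sum_neg_distrib, Finset.mul_sum, Finset.sum_filter]
    rw [Finset.sum_comm]
    congr 1
    refine Finset.sum_congr rfl fun 𝔟 _ => ?_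
    rw [Finset.sum_comm]
    refine Finset.sum_congr rfl fun 𝔠 _ => Finset.sum_congr rfl fun α _ => ?_
    split_ifs <;> ring
  have h3 : ∑ α ∈ B, w α * vA3 K U (Ideal.span {α}) =
      ∑ 𝔟 ∈ idealsLE K U, (idealMoebius 𝔟 : ℝ) *
        ∑ α ∈ B.filter (fun α => 𝔟 ∣ Ideal.span {α}), w α * Real.log (Ideal.absNorm (cofactor (Ideal.span {α}) 𝔟)) := by
    rw [Finset.sum_congr rfl fun α hα => by rw [vA3_eq (hne α hα)]]
    simp_rw [Finset.mul_sum, Finset.sum_filter]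
    rw [Finset.sum_comm]
    refine Finset.sum_congr rfl fun 𝔟 _ => Finset.sum_congr rfl fun α _ => ?_
    split_ifs <;> ring
  have h4 : ∑ α ∈ B, w α * vA4 K U (Ideal.span {α}) =
      -∑ 𝔟 ∈ (idealsLE K X).filter (fun 𝔟 => U < (Ideal.absNorm 𝔟 : ℝ)), idealVonMangoldt 𝔟 *
        ∑ α ∈ B.filter (fun α => 𝔟 ∣ Ideal.span {α} ∧ cofactor (Ideal.span {α}) 𝔟 ≠ ⊤),
          w α * eU K U (cofactor (Ideal.span {α}) 𝔟) := by
    rw [Finset.sum_congr rfl fun α hα => by rw [vA4_eq (hne α hα) (hXn α hα)]]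
    simp_rw [mul_neg, Finset.sum_neg_distrib, Finset.mul_sum, Finset.sum_filter]
    rw [Finset.sum_comm]
    congr 1
    refine Finset.sum_congr rfl fun 𝔟 _ => ?_
    by_cases hUb : U < (Ideal.absNorm 𝔟 : ℝ)
    · simp only [hUb, if_true]
      refine Finset.sum_congr rfl fun α _ => ?_
      split_ifs <;> ring
    · simp only [hUb, if_false, Finset.sum_const_zero]
  rw [h1, h2, h3, h4]
  ring

end Summed


/-! ## Complex weights -/

section Complex

variable {K : Type*} [Field K] [NumberField K]

/-- **Vaughan's identity summed against complex weights** (the form used with `w(α) = Ω(α)χ(α)`):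
the identity `sum_mul_vonMangoldt_eq` with `w : 𝓞 K → ℂ` and all arithmetic functions cast to
`ℂ`. [cite: Hinz1988, §4 (4.1)–(4.4) and p. 186] -/
theorem sum_mul_vonMangoldt_eq_complex {U X : ℝ} (hU : 1 ≤ U) (B : Finset (𝓞 K)) (hB : ∀ α ∈ B, α ≠ 0)
    (hX : ∀ α ∈ B, |(Algebra.norm ℚ (α : K) : ℝ)| ≤ X) (w : 𝓞 K → ℂ) :
    ∑ α ∈ B, w α * (idealVonMangoldt (Ideal.span {α}) : ℂ) =
      (∑ α ∈ B, w α * (vA1 K U (Ideal.span {α}) : ℂ)) -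
      (∑ 𝔟 ∈ idealsLE K U, ∑ 𝔠 ∈ idealsLE K U, (idealVonMangoldt 𝔟 : ℂ) * (idealMoebius 𝔠 : ℂ) *
        ∑ α ∈ B.filter (fun α => 𝔟 * 𝔠 ∣ Ideal.span {α}), w α) +
      (∑ 𝔟 ∈ idealsLE K U, (idealMoebius 𝔟 : ℂ) *
        ∑ α ∈ B.filter (fun α => 𝔟 ∣ Ideal.span {α}),
          w α * (Real.log (Ideal.absNorm (cofactor (Ideal.span {α}) 𝔟)) : ℂ)) -
      ∑ 𝔟 ∈ (idealsLE K X).filter (fun 𝔟 => U < (Ideal.absNorm 𝔟 : ℝ)), (idealVonMangoldt 𝔟 : ℂ) *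
        ∑ α ∈ B.filter (fun α => 𝔟 ∣ Ideal.span {α} ∧ cofactor (Ideal.span {α}) 𝔟 ≠ ⊤),
          w α * (eU K U (cofactor (Ideal.span {α}) 𝔟) : ℂ) := by
  classical
  have hne : ∀ α ∈ B, Ideal.span {α} ≠ ⊥ := fun α hα => by rw [Ne, Ideal.span_singleton_eq_bot]; exact hB α hα
  have hXn : ∀ α ∈ B, (Ideal.absNorm (Ideal.span {α}) : ℝ) ≤ X := fun α hα => by
    rw [absNorm_span_eq_abs_norm]; exact hX α hα
  -- apply (4.1) termwise
  have h1 : ∑ α ∈ B, w α * (idealVonMangoldt (Ideal.span {α}) : ℂ) =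
      (∑ α ∈ B, w α * (vA1 K U (Ideal.span {α}) : ℂ)) + (∑ α ∈ B, w α * (vA2 K U (Ideal.span {α}) : ℂ)) +
      (∑ α ∈ B, w α * (vA3 K U (Ideal.span {α}) : ℂ)) + ∑ α ∈ B, w α * (vA4 K U (Ideal.span {α}) : ℂ) := by
    rw [← Finset.sum_add_distrib, ← Finset.sum_add_distrib, ← Finset.sum_add_distrib]
    refine Finset.sum_congr rfl fun α hα => ?_
    rw [vaughan_identity hU (hne α hα)]; push_cast; ring
  -- the three swaps
  have h2 : ∑ α ∈ B, w α * (vA2 K U (Ideal.span {α}) : ℂ) =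
      -∑ 𝔟 ∈ idealsLE K U, ∑ 𝔠 ∈ idealsLE K U, (idealVonMangoldt 𝔟 : ℂ) * (idealMoebius 𝔠 : ℂ) *
        ∑ α ∈ B.filter (fun α => 𝔟 * 𝔠 ∣ Ideal.span {α}), w α := by
    rw [Finset.sum_congr rfl fun α hα => by rw [vA2_eq (hne α hα)]]
    push_cast
    simp_rw [apply_ite Complex.ofReal, Complex.ofReal_zero, mul_neg, Finset.sum_neg_distrib,
      Finset.sum_filter, Finset.mul_sum]
    rw [Finset.sum_comm]
    congr 1
    refine Finset.sum_congr rfl fun 𝔟 _ => ?_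
    rw [Finset.sum_comm]
    refine Finset.sum_congr rfl fun 𝔠 _ => Finset.sum_congr rfl fun α _ => ?_
    split_ifs <;> push_cast <;> ring
  have h3 : ∑ α ∈ B, w α * (vA3 K U (Ideal.span {α}) : ℂ) =
      ∑ 𝔟 ∈ idealsLE K U, (idealMoebius 𝔟 : ℂ) *
        ∑ α ∈ B.filter (fun α => 𝔟 ∣ Ideal.span {α}),
          w α * (Real.log (Ideal.absNorm (cofactor (Ideal.span {α}) 𝔟)) : ℂ) := by
    rw [Finset.sum_congr rfl fun α hα => by rw [vA3_eq (hne α hα)]]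
    push_cast
    simp_rw [apply_ite Complex.ofReal, Complex.ofReal_zero, Finset.sum_filter, Finset.mul_sum]
    rw [Finset.sum_comm]
    refine Finset.sum_congr rfl fun 𝔟 _ => Finset.sum_congr rfl fun α _ => ?_
    split_ifs <;> push_cast <;> ring
  have h4 : ∑ α ∈ B, w α * (vA4 K U (Ideal.span {α}) : ℂ) =
      -∑ 𝔟 ∈ (idealsLE K X).filter (fun 𝔟 => U < (Ideal.absNorm 𝔟 : ℝ)), (idealVonMangoldt 𝔟 : ℂ) *
        ∑ α ∈ B.filter (fun α => 𝔟 ∣ Ideal.span {α} ∧ cofactor (Ideal.span {α}) 𝔟 ≠ ⊤),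
          w α * (eU K U (cofactor (Ideal.span {α}) 𝔟) : ℂ) := by
    rw [Finset.sum_congr rfl fun α hα => by rw [vA4_eq (hne α hα) (hXn α hα)]]
    push_cast
    simp_rw [apply_ite Complex.ofReal, Complex.ofReal_zero, mul_neg, Finset.sum_neg_distrib,
      Finset.sum_filter, Finset.mul_sum]
    rw [Finset.sum_comm]
    congr 1
    refine Finset.sum_congr rfl fun 𝔟 _ => ?_
    by_cases hUb : U < (Ideal.absNorm 𝔟 : ℝ)
    · simp only [hUb, if_true]
      refine Finset.sum_congr rfl fun α _ => ?_
      split_ifs <;> push_cast <;> ring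
    · simp only [hUb, if_false, mul_zero, Finset.sum_const_zero]
  rw [h1, h2, h3, h4]
  ring

end Complex

end Literature.NumberTheory.Sieve.NumberFieldVaughan
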